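/-
Copyright (c) 2026 the pub-hodgecm-mathlib formalisation cell (harness21).  Prover seat hodgecm-mathlib-K2E3-p23 (g6), HCML Track B «K2-LIT» ∕ h413
(`stmt-HodgeConjecture-24833`), line `K2_E3_EllipticInputs`, road «GL₂-sc» (road owner K2E5-p17 (g5), dealer K2E3-plan (g4)), NON-ELLIPTIC half, brick 2N-7,
FILE 2 OF 3: the `Fin 2` reading of ★ ASM-1d `K2E3GL3ModUniformizerNonEllCancellation` (K2E3-p23 (g5)) — `hcanc` PACKAGED: for a.e. non-elliptic `x̄ ∈ G' = GL₂(F) ⧸ ϖ^ℤ`,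
`∫_{Ω n} θ(z x̄ z⁻¹) = ∫_{Ω n ∩ Ω (R x̄)} θ(z x̄ z⁻¹)` with `R x̄ = 22·(s₀ + h x̄ + L x̄ + 1)`.  No mixed half at `N = 2`: UNCONDITIONAL.  2026-09-04.
-/
import Summits.HodgeConjecture.HodgeConjecture.Theorems.K2E3GL2ModUniformizerBallBoundSplit          -- ★ 2N-5 part 2 p859044 (K2E3-p17 g8): generic `mul_zpowDiagGL_conj_glDiagonal`; brings ★ 2N-5 part 1, ★ 2N-0c F3, ★ 2N-1, ★ 2N-2
import Summits.HodgeConjecture.HodgeConjecture.Theorems.K2E3GL2ModUniformizerSeparableAE              -- ★ 2N-0d p858891 (this seat): `ae_isCompact_centralizer_or_normalForm`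
import Summits.HodgeConjecture.HodgeConjecture.Theorems.K2E3GL2FinConjBoxes                          -- ★ (2E-a1) p858857 (K2E5-p17 g5): `v_det_le_of_entries_le` at `Fin 2`
import Summits.HodgeConjecture.HodgeConjecture.Theorems.K2E3GL2BorelSliceLowerCell                    -- ★ (K2E5-p10 g4): `discr_charpoly_fin_two_explicit`
import Summits.HodgeConjecture.HodgeConjecture.Theorems.K2E3GL3ModUniformizerNonEllBallMixed           -- ★ (K2E3-p23 g5): GENERIC `normAbs_uniformizer_eq_inv`; brings ★ GL3 NonEllBallSplit∕NonEllBall generic helpers (`exists_nat_v_eq_exp_neg`, `v_sub_le_one` live in NonEllBall)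
import Summits.HodgeConjecture.HodgeConjecture.Theorems.K2E3GL3ModUniformizerNonEllBall                -- ★ (K2E3-p23 g5): GENERIC `exists_nat_v_eq_exp_neg`, `v_sub_le_one`
import Summits.HodgeConjecture.HodgeConjecture.Theorems.K2E3GL2SupercuspOrbitalSliceCancellation   -- ★ 2N-4 F3 p859052 (this seat): the split per-point `hcanc`
import Summits.HodgeConjecture.HodgeConjecture.Theorems.K2E3GL3ModUniformizerNonEllCancellation    -- ★ ASM-1d (K2E3-p23 g5): GENERIC §1 `setIntegral_eq_inter_of_le`
import HarnessLib

/-!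
# Road «GL₂-sc», non-elliptic half, brick 2N-7 (file 2 of 3): `hcanc` packaged — a.e. truncation of the conjugation integrals off the elliptic set of `G' = GL₂(F) ⧸ ϖ^ℤ`

Cell `pub/hodgecm-mathlib` (D-0151), Track B «K2-LIT», crux H413 = `stmt-HodgeConjecture-24833`, route of record `HCCMUnconditional`.  Lane
`--supports stmt-HodgeConjecture-24833 --as helper`; THEOREMS ONLY (no `def`, no `instance`, no `notation`, no named-fact hypothesis, no `sorry`); count-neutral.
`Fin 2` reading of ★ ASM-1d (road «GL-[M6]-sc»), WITHOUT the mixed binder `HM` (at `N = 2` a non-elliptic regular semisimple class is split, ★ 2N-0d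
`ae_isCompact_centralizer_or_normalForm`).  The split per-point statement is ★ 2N-4 F3 `setIntegral_conj_eq_setIntegral_inter_split` (radius
`(2s₀+L₀) + (1+2s+4(2s₀+L₀)) + s` at `mk(y γ y⁻¹)`, `γ` regular diagonal of depth `L₀`, `𝔅_s(y)`); here it is moved to an a.e. `x̄`: a.e. split normal form with a lift `g`
(★ 2N-0d), integral representative `g₁ = ϖ^k g` (★ B4-0 `exists_zpow_scalar_mul_integral_of_adBall` with the height `h = h(x̄)`), conjugator of height `2h + L₀` (★ T18₂
`exists_adBall_mul_zpowDiagGL_of_adBall_conj`), and `L₀ ≤ L(x̄) + 2h` (`‖disc χ_{g₁}‖ = δ(x̄)·‖det g₁‖`, `‖det g₁‖ ≥ q^{-2h}` by ★ (2E-a1) `v_det_le_of_entries_le`), so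
that the radius `10s₀ + 6h + 8L₀ + 1` is dominated by the class function `R x̄ = 22·(s₀ + h(x̄) + L(x̄) + 1)` (★ generic `setIntegral_eq_inter_of_le`).
* §1 `le_add_of_pow_eq_of_pow_mul_le` (`s^{L₀} = δ·a`, `s^L ≤ δ`, `s^k ≤ a` ⇒ `L₀ ≤ L + k`); §2 **`ae_setIntegral_conj_eq_inter`**.
HONEST LABEL: HC_CM is proved only modulo the 7 printed citations (2 remaining named inputs: hLiu418 = stmt-HodgeConjecture-24832, h413 = stmt-HodgeConjecture-24833) until
rung 0 closes; count-neutral helper, closes no socket.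

## References
* [HarishChandra1970] Harish-Chandra (notes by G. van Dijk), *Harmonic Analysis on Reductive p-adic Groups*, LNM 162 (1970), Part VII §2 Theorems 18, 20 pp. 69–70; §3 pp. 71–73.
-/

set_option autoImplicit false
-- the mandated namespace repeats the single-problem summit's segment (`HodgeConjecture.HodgeConjecture`)
set_option linter.dupNamespace false

noncomputable section

open MeasureTheory Measure Set
open scoped MatrixGroups NNReal ENNReal WithZero
open Literature.NumberTheory.Automorphic Literature.NumberTheory.GaloisRepresentations Literature.NumberTheory.GaloisRepresentations.IsNonarchimedeanLocalField
open Summit.HodgeConjecture.HodgeConjecture.Cruxes.H413.K2E3GL2ModUniformizerBallBoundSplit (mul_zpowDiagGL_conj_glDiagonal)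
open Summit.HodgeConjecture.HodgeConjecture.Cruxes.H413.K2E3GL2BorelSliceLowerCell (discr_charpoly_fin_two_explicit)
open Summit.HodgeConjecture.HodgeConjecture.Cruxes.H413.K2E3GL2TruncatedCharSplitTorusRadius (exists_adBall_mul_zpowDiagGL_of_adBall_conj)
open Summit.HodgeConjecture.HodgeConjecture.Cruxes.H413.K2E3GL3TruncatedCharSplitTorusRadius (v_eigenvalue_le_one_of_conj)
open Summit.HodgeConjecture.HodgeConjecture.Cruxes.H413.K2E3GLnAdHeightBalls
open Summit.HodgeConjecture.HodgeConjecture.Cruxes.H413.K2E3GL2ModUniformizerFundamentalDomain (mk_scalar_zpow_mul)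
open Summit.HodgeConjecture.HodgeConjecture.Cruxes.H413.K2E3GL2ModUniformizerSeparableAE (ae_isCompact_centralizer_or_normalForm)
open Summit.HodgeConjecture.HodgeConjecture.Cruxes.H413.K2E3GL3ModUniformizerNonEllBall (exists_nat_v_eq_exp_neg v_sub_le_one)
open Summit.HodgeConjecture.HodgeConjecture.Cruxes.H413.K2E3GL3ModUniformizerNonEllBallMixed (normAbs_uniformizer_eq_inv)
open Summit.HodgeConjecture.HodgeConjecture.Cruxes.H413.K2E3GL2SupercuspOrbitalSliceCancellation (setIntegral_conj_eq_setIntegral_inter_split)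
open Summit.HodgeConjecture.HodgeConjecture.Cruxes.H413.K2E3GL3ModUniformizerNonEllCancellation (setIntegral_eq_inter_of_le)

namespace Summit.HodgeConjecture.HodgeConjecture.Cruxes.H413.K2E3GL2ModUniformizerNonEllCancellation

/-! ## §1 Exponent bookkeeping -/

/-- `s^{L₀} = δ·a` with `s^{L} ≤ δ`, `s^{k} ≤ a`, `0 < s < 1` ⇒ `L₀ ≤ L + k` (the `N = 2` depth comparison: `‖disc χ_{g₁}‖ = δ·‖det g₁‖`). [folklore] -/
theorem le_add_of_pow_eq_of_pow_mul_le {s δ a : ℝ≥0} (hs0 : 0 < s) (hs1 : s < 1) {L₀ L k : ℕ}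
    (hD : s ^ L₀ = δ * a) (hL : s ^ L ≤ δ) (hk : s ^ k ≤ a) : L₀ ≤ L + k := by
  have h : s ^ (L + k) ≤ s ^ L₀ := by
    rw [hD, pow_add]
    exact mul_le_mul' hL hk
  exact (pow_le_pow_iff_right_of_lt_one₀ hs0 hs1).1 h

/-! ## §2 `hcanc`, packaged -/

variable {F : Type*} [Field F] [Valued F ℤᵐ⁰] [ValuativeRel F] [(Valued.v : Valuation F ℤᵐ⁰).Compatible] [IsNonarchimedeanLocalField F] [CharZero F]
  [MeasurableSpace F] [BorelSpace F] [MeasurableSpace (GL (Fin 2) F)] [BorelSpace (GL (Fin 2) F)]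
  {ϖ : F} (hϖ : Valued.v ϖ = WithZero.exp (-1 : ℤ)) (hϖ0 : ϖ ≠ 0)
  [((Subgroup.zpowers (Units.mk0 ϖ hϖ0)).map (Matrix.GeneralLinearGroup.scalar (Fin 2))).Normal]
  [MeasurableSpace (GL (Fin 2) F ⧸ (Subgroup.zpowers (Units.mk0 ϖ hϖ0)).map (Matrix.GeneralLinearGroup.scalar (Fin 2)))]
  [BorelSpace (GL (Fin 2) F ⧸ (Subgroup.zpowers (Units.mk0 ϖ hϖ0)).map (Matrix.GeneralLinearGroup.scalar (Fin 2)))]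
  {V : Type*} [AddCommGroup V] [Module ℂ V] (ρ : Representation ℂ (GL (Fin 2) F ⧸ (Subgroup.zpowers (Units.mk0 ϖ hϖ0)).map (Matrix.GeneralLinearGroup.scalar (Fin 2))) V)
  (hρ : ρ.IsSmooth) (hsc : ρ.IsSupercuspidal) {B : V →ₗ⋆[ℂ] V →ₗ[ℂ] ℂ}
  (hBinv : ∀ (g : GL (Fin 2) F ⧸ (Subgroup.zpowers (Units.mk0 ϖ hϖ0)).map (Matrix.GeneralLinearGroup.scalar (Fin 2))) (v w : V), B (ρ g v) (ρ g w) = B v w) (u u' : V)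
  (Ω : CompactExhaustion (GL (Fin 2) F ⧸ (Subgroup.zpowers (Units.mk0 ϖ hϖ0)).map (Matrix.GeneralLinearGroup.scalar (Fin 2))))
  (hmem : ∀ (m : ℕ) (g : GL (Fin 2) F),
    (QuotientGroup.mk g : GL (Fin 2) F ⧸ (Subgroup.zpowers (Units.mk0 ϖ hϖ0)).map (Matrix.GeneralLinearGroup.scalar (Fin 2))) ∈ Ω m ↔
      ∀ i j k l, Valued.v (ϖ ^ m * ((g : Matrix (Fin 2) (Fin 2) F) i j * ((g⁻¹ : GL (Fin 2) F) : Matrix (Fin 2) (Fin 2) F) k l)) ≤ 1)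
  (hK : ∀ (m : ℕ) (k : GL (Fin 2) F), k ∈ glInt 2 F → ∀ x : GL (Fin 2) F ⧸ (Subgroup.zpowers (Units.mk0 ϖ hϖ0)).map (Matrix.GeneralLinearGroup.scalar (Fin 2)),
    ((QuotientGroup.mk k : GL (Fin 2) F ⧸ _) * x ∈ Ω m ↔ x ∈ Ω m) ∧ (x * (QuotientGroup.mk k : GL (Fin 2) F ⧸ _) ∈ Ω m ↔ x ∈ Ω m))
  (μ' : Measure (GL (Fin 2) F ⧸ (Subgroup.zpowers (Units.mk0 ϖ hϖ0)).map (Matrix.GeneralLinearGroup.scalar (Fin 2)))) [μ'.IsHaarMeasure]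

include hϖ hρ hsc hBinv hmem hK in
/-- **`hcanc` PACKAGED, UNCONDITIONALLY (no mixed half at `N = 2`).**  `θ = B u' (ρ · u)` supported in `Ω s₀`; coordinates `h`, `δ`, `L` as in ★ 2N-7 F1 `exists_coordinates`
(`δ(mk g) = ‖disc χ_g‖ ∕ ‖det g‖`).  Then for every `n`, for `μ'`-a.e. `x̄` with non-compact centraliser,
`∫_{Ω n} θ(z x̄ z⁻¹) dμ'(z) = ∫_{Ω n ∩ Ω (22·(s₀ + h x̄ + L x̄ + 1))} θ(z x̄ z⁻¹) dμ'(z)`.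
[cite: HarishChandra1970, Part VII §2 Theorems 18, 20 pp. 69–70; §3 pp. 71–73] -/
theorem ae_setIntegral_conj_eq_inter {s₀ : ℕ}
    (hθ : ∀ g : GL (Fin 2) F ⧸ (Subgroup.zpowers (Units.mk0 ϖ hϖ0)).map (Matrix.GeneralLinearGroup.scalar (Fin 2)), B u' (ρ g u) ≠ 0 → g ∈ Ω s₀)
    (hgt : GL (Fin 2) F ⧸ (Subgroup.zpowers (Units.mk0 ϖ hϖ0)).map (Matrix.GeneralLinearGroup.scalar (Fin 2)) → ℕ)
    (δ : GL (Fin 2) F ⧸ (Subgroup.zpowers (Units.mk0 ϖ hϖ0)).map (Matrix.GeneralLinearGroup.scalar (Fin 2)) → ℝ≥0)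
    (L : GL (Fin 2) F ⧸ (Subgroup.zpowers (Units.mk0 ϖ hϖ0)).map (Matrix.GeneralLinearGroup.scalar (Fin 2)) → ℕ)
    (hhgt : ∀ x, x ∈ Ω (hgt x))
    (hδ : ∀ g : GL (Fin 2) F, δ (QuotientGroup.mk g) =
      normAbs F ((g : Matrix (Fin 2) (Fin 2) F)).charpoly.discr / normAbs F ((g : Matrix (Fin 2) (Fin 2) F)).det)
    (hL : ∀ x, δ x ≠ 0 → ((residueFieldCard F : ℝ≥0)⁻¹) ^ (L x) ≤ δ x)
    (n : ℕ) :
    ∀ᵐ x ∂μ', ¬ IsCompact ((Subgroup.centralizer {x} :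
          Subgroup (GL (Fin 2) F ⧸ (Subgroup.zpowers (Units.mk0 ϖ hϖ0)).map (Matrix.GeneralLinearGroup.scalar (Fin 2)))) :
        Set (GL (Fin 2) F ⧸ (Subgroup.zpowers (Units.mk0 ϖ hϖ0)).map (Matrix.GeneralLinearGroup.scalar (Fin 2)))) →
      ∫ z in Ω n, B u' (ρ (z * x * z⁻¹) u) ∂μ' = ∫ z in Ω n ∩ Ω (22 * (s₀ + hgt x + L x + 1)), B u' (ρ (z * x * z⁻¹) u) ∂μ' := by
  filter_upwards [ae_isCompact_centralizer_or_normalForm hϖ hϖ0 μ'] with x hx hnc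
  obtain ⟨g, rfl, -, y, d, hd, hg⟩ := hx.resolve_left hnc
  -- the height and the integral representative `g₁ = ϖ^k g`
  set h : ℕ := hgt (QuotientGroup.mk g) with hhdef
  have hball : ∀ i j k l, Valued.v (ϖ ^ h * ((g : Matrix (Fin 2) (Fin 2) F) i j * ((g⁻¹ : GL (Fin 2) F) : Matrix (Fin 2) (Fin 2) F) k l)) ≤ 1 :=
    (hmem h g).1 (hhgt _)
  obtain ⟨k, hint, hinv⟩ := exists_zpow_scalar_mul_integral_of_adBall hϖ hϖ0 hball
  set g₁ : GL (Fin 2) F := Matrix.GeneralLinearGroup.scalar (Fin 2) (Units.mk0 ϖ hϖ0 ^ k) * g with hg₁def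
  have hmk : (QuotientGroup.mk g₁ : GL (Fin 2) F ⧸ (Subgroup.zpowers (Units.mk0 ϖ hϖ0)).map (Matrix.GeneralLinearGroup.scalar (Fin 2))) =
      QuotientGroup.mk g := mk_scalar_zpow_mul hϖ0 k g
  have hu : ((Units.mk0 ϖ hϖ0 ^ k : Fˣ) : F) ≠ 0 := (Units.mk0 ϖ hϖ0 ^ k).ne_zero
  -- `g₁` is again of split normal form: `g₁ = y · diag(d₁) · y⁻¹`, `d₁ = ϖ^k • d`
  set d₁ : Fin 2 → F := fun i => ((Units.mk0 ϖ hϖ0 ^ k : Fˣ) : F) * d i with hd₁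
  have hdiag : ((Units.mk0 ϖ hϖ0 ^ k : Fˣ) : F) • Matrix.diagonal d = Matrix.diagonal d₁ := by
    rw [Matrix.smul_eq_diagonal_mul, Matrix.diagonal_mul_diagonal]
  have hg₁ : (g₁ : Matrix (Fin 2) (Fin 2) F) = (y : Matrix (Fin 2) (Fin 2) F) * Matrix.diagonal d₁ * ((y⁻¹ : GL (Fin 2) F) : Matrix (Fin 2) (Fin 2) F) := by
    rw [hg₁def, Units.val_mul, Matrix.GeneralLinearGroup.coe_scalar, Matrix.scalar_apply, ← Matrix.smul_eq_diagonal_mul, hg, ← hdiag, Matrix.mul_smul,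
      Matrix.smul_mul]
  have hd' : Function.Injective d₁ := fun i j hij => hd (mul_left_cancel₀ hu hij)
  -- every `d₁ i ≠ 0`, and `g₁ = y · glDiagonal t · y⁻¹` in `GL₂`
  have hd0 : ∀ i, d₁ i ≠ 0 := by
    intro i h0
    have h1 : (g₁ : Matrix (Fin 2) (Fin 2) F).det = 0 := by
      rw [hg₁, Matrix.det_mul, Matrix.det_mul, Matrix.det_diagonal, Finset.prod_eq_zero (Finset.mem_univ i) h0, mul_zero, zero_mul]
    exact ((Matrix.isUnit_iff_isUnit_det _).1 (Units.isUnit g₁)).ne_zero h1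
  set t : Fin 2 → Fˣ := fun i => Units.mk0 (d₁ i) (hd0 i) with ht
  have htd : ((glDiagonal 2 F t : GL (Fin 2) F) : Matrix (Fin 2) (Fin 2) F) = Matrix.diagonal d₁ := by
    rw [coe_glDiagonal]; exact congrArg Matrix.diagonal (funext fun i => rfl)
  have hg' : g₁ = y * glDiagonal 2 F t * y⁻¹ := by
    refine Units.ext ?_
    rw [hg₁]
    rw [Units.val_mul, Units.val_mul, htd, Matrix.coe_units_inv]
  have hy : ∀ i j, Valued.v ((((y * glDiagonal 2 F t * y⁻¹ : GL (Fin 2) F)) : Matrix (Fin 2) (Fin 2) F) i j) ≤ 1 := by rw [← hg']; exact hint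
  have ht1 : ∀ i, Valued.v (d₁ i) ≤ 1 := fun i => v_eigenvalue_le_one_of_conj htd hy i
  have hs : ∀ i j k' l, Valued.v (ϖ ^ h * (((y * glDiagonal 2 F t * y⁻¹ : GL (Fin 2) F) : Matrix (Fin 2) (Fin 2) F) i j *
      (((y * glDiagonal 2 F t * y⁻¹)⁻¹ : GL (Fin 2) F) : Matrix (Fin 2) (Fin 2) F) k' l)) ≤ 1 := by
    rw [← hg']
    intro i j k' l
    rw [mul_left_comm, map_mul]
    exact mul_le_one' (hint i j) (hinv k' l)
  -- `disc χ_{g₁} = (d₁ 0 − d₁ 1)²`, `|ϖ^{2h}| ≤ |det g₁|`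
  have hdisc : ((g₁ : Matrix (Fin 2) (Fin 2) F)).charpoly.discr = (d₁ 0 - d₁ 1) ^ 2 := by
    have hdm : Matrix.diagonal d₁ = !![d₁ 0, 0; 0, d₁ 1] := by
      ext i j; fin_cases i <;> fin_cases j <;> simp
    rw [hg₁, Matrix.coe_units_inv, Matrix.charpoly_units_conj, hdm, discr_charpoly_fin_two_explicit]; ring
  have hvdet : Valued.v ((ϖ ^ h) ^ 2) ≤ Valued.v ((g₁ : Matrix (Fin 2) (Fin 2) F)).det := by
    set Z : Matrix (Fin 2) (Fin 2) F := ϖ ^ h • (((g₁⁻¹ : GL (Fin 2) F)) : Matrix (Fin 2) (Fin 2) F) with hZ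
    have hZ1 : Valued.v Z.det ≤ 1 := by
      have h' := K2E3GL2FinConjBoxes.v_det_le_of_entries_le (M := 0) Z
        (fun i j => by rw [WithZero.exp_zero, hZ, Matrix.smul_apply, smul_eq_mul]; exact hinv i j)
      rwa [mul_zero, WithZero.exp_zero] at h'
    have hZdet : Z.det * ((g₁ : GL (Fin 2) F) : Matrix (Fin 2) (Fin 2) F).det = (ϖ ^ h) ^ 2 := by
      rw [hZ, Matrix.det_smul, Fintype.card_fin, mul_assoc, ← Matrix.det_mul, ← Units.val_mul, inv_mul_cancel, Units.val_one, Matrix.det_one, mul_one]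
    rw [← hZdet, map_mul]
    exact mul_le_of_le_one_left' hZ1
  -- `δ x̄ = ‖disc χ_{g₁}‖ ∕ ‖det g₁‖`, nonzero; the depth exponent `L₀ ≤ L x̄ + 2h`
  have hdisc0 : ((g₁ : Matrix (Fin 2) (Fin 2) F)).charpoly.discr ≠ 0 := by
    rw [hdisc]; exact pow_ne_zero _ (sub_ne_zero.2 fun h' => absurd (hd' h') (by decide))
  have hdisc1 : Valued.v ((g₁ : Matrix (Fin 2) (Fin 2) F)).charpoly.discr ≤ 1 := by
    rw [hdisc, map_pow]; exact pow_le_one₀ zero_le (v_sub_le_one (ht1 0) (ht1 1))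
  obtain ⟨L₀, hL₀⟩ := exists_nat_v_eq_exp_neg hdisc0 hdisc1
  have hdet0 : ((g₁ : Matrix (Fin 2) (Fin 2) F)).det ≠ 0 := ((Matrix.isUnit_iff_isUnit_det _).1 (Units.isUnit g₁)).ne_zero
  have ha0 : normAbs F ((g₁ : Matrix (Fin 2) (Fin 2) F)).det ≠ 0 := (_root_.map_ne_zero _).2 hdet0
  have hδx : δ (QuotientGroup.mk g) = normAbs F ((g₁ : Matrix (Fin 2) (Fin 2) F)).charpoly.discr / normAbs F ((g₁ : Matrix (Fin 2) (Fin 2) F)).det := by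
    rw [← hmk]; exact hδ g₁
  have hδ0 : δ (QuotientGroup.mk g) ≠ 0 := by
    rw [hδx]; exact div_ne_zero ((_root_.map_ne_zero _).2 hdisc0) ha0
  have hDeq : normAbs F ((g₁ : Matrix (Fin 2) (Fin 2) F)).charpoly.discr = δ (QuotientGroup.mk g) * normAbs F ((g₁ : Matrix (Fin 2) (Fin 2) F)).det := by
    rw [hδx, div_mul_cancel₀ _ ha0]
  have hq : normAbs F ϖ = (residueFieldCard F : ℝ≥0)⁻¹ := normAbs_uniformizer_eq_inv hϖ
  have hs0 : (0 : ℝ≥0) < (residueFieldCard F : ℝ≥0)⁻¹ := inv_residueFieldCard_pos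
  have hs1 : (residueFieldCard F : ℝ≥0)⁻¹ < 1 := inv_residueFieldCard_lt_one
  have hdet : ((residueFieldCard F : ℝ≥0)⁻¹) ^ (2 * h) ≤ normAbs F ((g₁ : Matrix (Fin 2) (Fin 2) F)).det := by
    have hn : normAbs F ((ϖ ^ h) ^ 2) ≤ normAbs F ((g₁ : Matrix (Fin 2) (Fin 2) F)).det :=
      normAbs_le_normAbs_iff.2 ((v_le_iff_valuation_le _ _).1 hvdet)
    rwa [map_pow, map_pow, hq, ← pow_mul, mul_comm] at hn
  have hϖL : Valued.v (ϖ ^ L₀) = WithZero.exp (-(L₀ : ℤ)) := by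
    rw [map_pow, hϖ, ← WithZero.exp_nsmul]; congr 1; simp
  have hDL : ((residueFieldCard F : ℝ≥0)⁻¹) ^ L₀ = normAbs F ((g₁ : Matrix (Fin 2) (Fin 2) F)).charpoly.discr := by
    have hv : Valued.v ((g₁ : Matrix (Fin 2) (Fin 2) F)).charpoly.discr = Valued.v (ϖ ^ L₀) := by rw [hL₀, hϖL]
    have h1 := normAbs_le_normAbs_iff.2 ((v_le_iff_valuation_le _ _).1 hv.le)
    have h2' := normAbs_le_normAbs_iff.2 ((v_le_iff_valuation_le _ _).1 hv.ge)
    rw [map_pow, hq] at h1 h2'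
    exact le_antisymm h2' h1
  have hLle : L₀ ≤ L (QuotientGroup.mk g) + 2 * h := le_add_of_pow_eq_of_pow_mul_le hs0 hs1 (hDL.trans hDeq) (hL _ hδ0) hdet
  -- depth hypothesis of ★ T18₂ ∕ ★ 2N-4 F3 and the conjugator of height `2h + L₀`
  have hDd : Valued.v (ϖ ^ L₀ * (d₁ 0 * d₁ 1)) ≤ Valued.v ((d₁ 0 - d₁ 1) ^ 2) := by
    rw [map_mul, hϖL, ← hdisc, hL₀]
    refine mul_le_of_le_one_right zero_le ?_
    rw [map_mul]; exact mul_le_one' (ht1 0) (ht1 1)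
  obtain ⟨ev, hev⟩ := exists_adBall_mul_zpowDiagGL_of_adBall_conj hϖ hϖ0 htd hs hDd
  have hconj : (y * zpowDiagGL (n := 2) hϖ0 ev) * glDiagonal 2 F t * (y * zpowDiagGL (n := 2) hϖ0 ev)⁻¹ = g₁ := by
    rw [mul_zpowDiagGL_conj_glDiagonal hϖ0 y t ev, ← hg']
  have key := setIntegral_conj_eq_setIntegral_inter_split hϖ hϖ0 ρ hρ hsc hBinv u u' Ω hmem hK μ' hθ htd hd' hDd hev
  rw [hconj, hmk] at key
  refine setIntegral_eq_inter_of_le μ' Ω _ ?_ key n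
  omega

end Summit.HodgeConjecture.HodgeConjecture.Cruxes.H413.K2E3GL2ModUniformizerNonEllCancellation

end
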